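import Literature.NumberTheory.NumberFields.EisensteinFieldLambda
import Literature.NumberTheory.NumberFields.SelmerGroupPIDPowers
import Literature.NumberTheory.EllipticCurves.MordellCurveCubicDescentLocal
import Mathlib.NumberTheory.Padics.PadicVal.Basic
import HarnessLib

/-!
# `K(S, 3)` of `ℚ(ζ₃)` for `S = {λ, 2, 5}`: normal forms `±ζ^i λ^j 2^k 5^l w³` and their local data

Topic `NumberTheory/NumberFields`. For the `√−3`-descent on the cubic twists
`y² = x³ + (2^a 5^b)²`
(`Literature/Barriers/BirchSwinnertonDyer/RankNotSumOfLocalInvariantsCubicTwists.lean`) the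
descent values `δ(P) ∈ K3ˣ` have cube valuations away from `30`; this file makes the resulting
finite group explicit and tabulates the local invariants of its elements:

* `K3.exists_normal_form`: if `3 ∣ ord_v(b)` for all finite places `v ∌ 30` of `K3 = ℚ(ζ₃)`, then
  `b = s ζ^i (ζ − 1)^j 2^k 5^l w³` with `s = ±1`, `i, j, k, l < 3`, `w ≠ 0` — the tree's
  `exists_eq_unit_mul_prod_pow_mul_pow` (`K(S, n)` for class number one, Silverman *AEC*
  Prop. VIII.1.6 / X.4.9) for `𝓞 K3` a PID with units `±ζ^i` and `S = {λ, 2, 5}` the primes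
  dividing `30` (`EisensteinFieldIntegers.lean`);
* the valuations of a normal form at `λ`, `2`, `5` (`log_vL_normalForm`, `log_val2_normalForm`,
  `log_val5_normalForm`): `−j`, `−k`, `−l` modulo `3`;
* for `j = 0`, its residue characters (`EisensteinFieldLocal/Lambda.lean`): `χ₂ = i`, `χ₅ = 2i`,
  `μ = 2k + l` (`chi2_normalForm`, `chi5_normalForm`, `mu_normalForm`);
* its class modulo cubes: `[s ζ^i λ^j 2^k 5^l w³] = [ζ^i λ^j 2^k 5^l]` (`cubeClass_normalForm`);
* lower-bound tool: a rational `q` with `3 ∤ ord_p(q)` for some prime `p` is not a cube in `K3`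
  (`K3.ratCast_ne_cube`, norms: `q² = N(w)³`), hence `[q] ≠ [q']` when `3 ∤ ord_p(q/q')`
  (`cubeClass_ratCast_ne`).

## References

* J. H. Silverman, *The Arithmetic of Elliptic Curves*, 2nd ed., GTM 106 (2009), Prop. VIII.1.6,
  Prop. X.4.9, Exercise 10.9. [SilvermanAEC2009]
* K. Ireland, M. Rosen, *A Classical Introduction to Modern Number Theory*, 2nd ed., GTM 84
  (1990), Ch. 9 §1. [IrelandRosen1990]
-/

noncomputable section

open QuadraticAlgebra NumberField IsDedekindDomain IsDedekindDomain.HeightOneSpectrum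
open WithZero (log exp)
open scoped WithZero
open Literature.NumberTheory.EllipticCurves.MordellDescent (cubeClass CubeUnits cubeClass_mul
  cubeClass_neg cubeClass_mul_pow_three cubeClass_eq_cubeClass_iff)

namespace Literature.NumberTheory.NumberFields

namespace K3

/-! ### The normal form -/

/-- The generators `λ = ζ − 1`, `2`, `5` of the `S`-part of `K(S, 3)`. [folklore] -/
def gens : Fin 3 → 𝓞 K3 := ![lamInt, 2, 5]

/-- `((2 : 𝓞 K3) : K3) = 2`. [folklore] -/
@[simp] theorem algebraMap_two : algebraMap (𝓞 K3) K3 2 = 2 := map_ofNat _ 2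

/-- `((5 : 𝓞 K3) : K3) = 5`. [folklore] -/
@[simp] theorem algebraMap_five : algebraMap (𝓞 K3) K3 5 = 5 := map_ofNat _ 5

/-- Every prime element dividing `30` is associated to a generator. [folklore] -/
theorem gens_spec (q : 𝓞 K3) (hq : Prime q) (h : q ∣ 30) : ∃ i, Associated q (gens i) := by
  rcases associated_of_prime_of_dvd_thirty hq h with h | h | h
  · exact ⟨0, h⟩
  · exact ⟨1, h⟩
  · exact ⟨2, h⟩

/-- **Normal form of `K(S, 3)`, `S = {λ, 2, 5}`**: if `b ∈ K3ˣ` has `3 ∣ ord_v(b)` for every finite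
place `v ∌ 30`, then `b = s ζ^i (ζ − 1)^j 2^k 5^l w³` with `s = ±1`, `i, j, k, l < 3`, `w ≠ 0`.
[cite: SilvermanAEC2009, Prop. VIII.1.6 (proof)] -/
theorem exists_normal_form {b : K3} (hb : b ≠ 0)
    (hval : ∀ v : HeightOneSpectrum (𝓞 K3), (30 : 𝓞 K3) ∉ v.asIdeal →
      (3 : ℤ) ∣ log (v.valuation K3 b)) :
    ∃ (s : ℤ) (i j k l : ℕ) (w : K3), (s = 1 ∨ s = -1) ∧ i < 3 ∧ j < 3 ∧ k < 3 ∧ l < 3 ∧ w ≠ 0 ∧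
      b = s * zeta ^ i * (zeta - 1) ^ j * 2 ^ k * 5 ^ l * w ^ 3 := by
  obtain ⟨u, e, w, he, hw, h⟩ := exists_eq_unit_mul_prod_pow_mul_pow (K := K3) 30 gens gens_spec
    (n := 3) (by norm_num) hb hval
  obtain ⟨s, i, hs, hi, hu⟩ := exists_coe_unit_eq u
  refine ⟨s, i, e 0, e 1, e 2, w, hs, hi, he 0, he 1, he 2, hw, ?_⟩
  rw [h, Fin.prod_univ_three, hu]
  simp only [gens, Matrix.cons_val_zero, Matrix.cons_val_one, Matrix.cons_val, coe_lamInt]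
  have h2 : ((2 : 𝓞 K3) : K3) = 2 := algebraMap_two
  have h5 : ((5 : 𝓞 K3) : K3) = 5 := algebraMap_five
  simp only [h2, h5]
  ring

/-! ### Valuations of a normal form -/

section Valuations

variable {s : ℤ} (hs : s = 1 ∨ s = -1) (i j k l : ℕ) {w : K3} (hw : w ≠ 0)
include hs hw

/-- A normal form is non-zero. [folklore] -/
theorem normalForm_ne_zero : (s : K3) * zeta ^ i * (zeta - 1) ^ j * 2 ^ k * 5 ^ l * w ^ 3 ≠ 0 := by
  have hs0 : (s : K3) ≠ 0 := by rcases hs with rfl | rfl <;> norm_num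
  have hz : (zeta : K3) ≠ 0 := isPrimitiveRoot_zeta.ne_zero (by norm_num)
  exact mul_ne_zero (mul_ne_zero (mul_ne_zero (mul_ne_zero (mul_ne_zero hs0 (pow_ne_zero _ hz))
    (pow_ne_zero _ zeta_sub_one_ne_zero)) (pow_ne_zero _ two_ne_zero)) (pow_ne_zero _ (by norm_num)))
    (pow_ne_zero _ hw)

/-- Generic valuation of a normal form at a prime element `q`: additivity of `log ∘ val`.
[folklore] -/
theorem log_val_normalForm {q : 𝓞 K3} (hq : Prime q) :
    log (val hq ((s : K3) * zeta ^ i * (zeta - 1) ^ j * 2 ^ k * 5 ^ l * w ^ 3)) =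
      j * log (val hq (zeta - 1)) + k * log (val hq 2) + l * log (val hq 5) + 3 * log (val hq w) := by
  have hs0 : (s : K3) ≠ 0 := by rcases hs with rfl | rfl <;> norm_num
  have hz : (zeta : K3) ≠ 0 := isPrimitiveRoot_zeta.ne_zero (by norm_num)
  rw [Valuation.log_map_mul _ (by
      exact mul_ne_zero (mul_ne_zero (mul_ne_zero (mul_ne_zero hs0 (pow_ne_zero _ hz))
        (pow_ne_zero _ zeta_sub_one_ne_zero)) (pow_ne_zero _ two_ne_zero)) (pow_ne_zero _ (by norm_num)))
      (pow_ne_zero _ hw),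
    Valuation.log_map_mul _ (by
      exact mul_ne_zero (mul_ne_zero (mul_ne_zero hs0 (pow_ne_zero _ hz))
        (pow_ne_zero _ zeta_sub_one_ne_zero)) (pow_ne_zero _ two_ne_zero)) (pow_ne_zero _ (by norm_num)),
    Valuation.log_map_mul _ (by
      exact mul_ne_zero (mul_ne_zero hs0 (pow_ne_zero _ hz)) (pow_ne_zero _ zeta_sub_one_ne_zero))
      (pow_ne_zero _ two_ne_zero),
    Valuation.log_map_mul _ (mul_ne_zero hs0 (pow_ne_zero _ hz)) (pow_ne_zero _ zeta_sub_one_ne_zero),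
    Valuation.log_map_mul _ hs0 (pow_ne_zero _ hz),
    Valuation.log_map_pow, Valuation.log_map_pow, Valuation.log_map_pow, Valuation.log_map_pow,
    Valuation.log_map_pow, log_val_sign hq hs, log_val_zeta hq]
  ring

/-- **At `λ`**: `log vL = −j + 3 log vL(w)`. [folklore] -/
theorem log_vL_normalForm :
    log (vL ((s : K3) * zeta ^ i * (zeta - 1) ^ j * 2 ^ k * 5 ^ l * w ^ 3)) = -j + 3 * log (vL w) := by
  rw [vL, log_val_normalForm hs i j k l hw prime_lamInt, ← coe_lamInt, log_val_self,
    show (2 : K3) = ((2 : ℕ) : K3) by norm_num, log_val_lam_natCast (by norm_num),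
    show (5 : K3) = ((5 : ℕ) : K3) by norm_num, log_val_lam_natCast (by norm_num)]
  ring

/-- **At `2`**: `log val₂ = −k + 3 log val₂(w)`. [folklore] -/
theorem log_val2_normalForm :
    log (val prime_natCast_two ((s : K3) * zeta ^ i * (zeta - 1) ^ j * 2 ^ k * 5 ^ l * w ^ 3)) =
      -k + 3 * log (val prime_natCast_two w) := by
  rw [log_val_normalForm hs i j k l hw prime_natCast_two, log_val_zeta_sub_one,
    show (2 : K3) = ((2 : ℕ) : K3) by norm_num, log_val_natCast_self,
    show (5 : K3) = ((5 : ℕ) : K3) by norm_num, log_val_natCast_of_not_dvd _ (by norm_num)]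
  ring

/-- **At `5`**: `log val₅ = −l + 3 log val₅(w)`. [folklore] -/
theorem log_val5_normalForm :
    log (val prime_natCast_five ((s : K3) * zeta ^ i * (zeta - 1) ^ j * 2 ^ k * 5 ^ l * w ^ 3)) =
      -l + 3 * log (val prime_natCast_five w) := by
  rw [log_val_normalForm hs i j k l hw prime_natCast_five, log_val_zeta_sub_one,
    show (2 : K3) = ((2 : ℕ) : K3) by norm_num, log_val_natCast_of_not_dvd _ (by norm_num),
    show (5 : K3) = ((5 : ℕ) : K3) by norm_num, log_val_natCast_self]
  ring

/-- `3 ∣ log vL ⟹ j = 0` (`j < 3`). [folklore] -/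
theorem j_eq_zero_of_dvd (hj : j < 3)
    (h : (3 : ℤ) ∣ log (vL ((s : K3) * zeta ^ i * (zeta - 1) ^ j * 2 ^ k * 5 ^ l * w ^ 3))) :
    j = 0 := by
  rw [log_vL_normalForm hs i j k l hw] at h; omega

/-- `3 ∣ log val₂ ⟹ k = 0` (`k < 3`). [folklore] -/
theorem k_eq_zero_of_dvd (hk : k < 3)
    (h : (3 : ℤ) ∣ log (val prime_natCast_two ((s : K3) * zeta ^ i * (zeta - 1) ^ j * 2 ^ k * 5 ^ l * w ^ 3))) :
    k = 0 := by
  rw [log_val2_normalForm hs i j k l hw] at h; omega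

/-- `3 ∣ log val₅ ⟹ l = 0` (`l < 3`). [folklore] -/
theorem l_eq_zero_of_dvd (hl : l < 3)
    (h : (3 : ℤ) ∣ log (val prime_natCast_five ((s : K3) * zeta ^ i * (zeta - 1) ^ j * 2 ^ k * 5 ^ l * w ^ 3))) :
    l = 0 := by
  rw [log_val5_normalForm hs i j k l hw] at h; omega

end Valuations

/-! ### Residue characters of a normal form with `j = 0` -/

section Characters

variable {s : ℤ} (hs : s = 1 ∨ s = -1) (i k l : ℕ) {w : K3} (hw : w ≠ 0)
include hs hw

/-- **`χ₂` of a normal form** (`j = 0`): `χ₂ = i` (`χ₂(ζ) = 1`, `χ₂(ℚˣ) = 0`, `χ₂(w³) = 0`).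
[folklore] -/
theorem chi2_normalForm : chi2 ((s : K3) * zeta ^ i * 2 ^ k * 5 ^ l * w ^ 3) = i := by
  have hs0 : (s : K3) ≠ 0 := by rcases hs with rfl | rfl <;> norm_num
  have hz : (zeta : K3) ≠ 0 := isPrimitiveRoot_zeta.ne_zero (by norm_num)
  have H := cubicChar_mul_two
  have R := cubicChar_ratCast_two
  rw [chi2, chi_mul _ H (mul_ne_zero (mul_ne_zero (mul_ne_zero hs0 (pow_ne_zero _ hz))
      (pow_ne_zero _ two_ne_zero)) (pow_ne_zero _ (by norm_num))) (pow_ne_zero _ hw),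
    chi_mul _ H (mul_ne_zero (mul_ne_zero hs0 (pow_ne_zero _ hz)) (pow_ne_zero _ two_ne_zero))
      (pow_ne_zero _ (by norm_num)),
    chi_mul _ H (mul_ne_zero hs0 (pow_ne_zero _ hz)) (pow_ne_zero _ two_ne_zero),
    chi_mul _ H hs0 (pow_ne_zero _ hz), chi_intCast _ R, chi_pow _ H hz, chi_pow_three _ H hw,
    show (2 : K3) = ((2 : ℕ) : K3) by norm_num, chi_pow _ H (by norm_num), chi_natCast _ R,
    show (5 : K3) = ((5 : ℕ) : K3) by norm_num, chi_pow _ H (by norm_num), chi_natCast _ R,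
    ← chi2, chi2_zeta]
  ring

/-- **`χ₅` of a normal form** (`j = 0`): `χ₅ = 2i` (`χ₅(ζ) = 2`). [folklore] -/
theorem chi5_normalForm : chi5 ((s : K3) * zeta ^ i * 2 ^ k * 5 ^ l * w ^ 3) = 2 * i := by
  have hs0 : (s : K3) ≠ 0 := by rcases hs with rfl | rfl <;> norm_num
  have hz : (zeta : K3) ≠ 0 := isPrimitiveRoot_zeta.ne_zero (by norm_num)
  have H := cubicChar_mul_five
  have R := cubicChar_ratCast_five
  rw [chi5, chi_mul _ H (mul_ne_zero (mul_ne_zero (mul_ne_zero hs0 (pow_ne_zero _ hz))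
      (pow_ne_zero _ two_ne_zero)) (pow_ne_zero _ (by norm_num))) (pow_ne_zero _ hw),
    chi_mul _ H (mul_ne_zero (mul_ne_zero hs0 (pow_ne_zero _ hz)) (pow_ne_zero _ two_ne_zero))
      (pow_ne_zero _ (by norm_num)),
    chi_mul _ H (mul_ne_zero hs0 (pow_ne_zero _ hz)) (pow_ne_zero _ two_ne_zero),
    chi_mul _ H hs0 (pow_ne_zero _ hz), chi_intCast _ R, chi_pow _ H hz, chi_pow_three _ H hw,
    show (2 : K3) = ((2 : ℕ) : K3) by norm_num, chi_pow _ H (by norm_num), chi_natCast _ R,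
    show (5 : K3) = ((5 : ℕ) : K3) by norm_num, chi_pow _ H (by norm_num), chi_natCast _ R,
    ← chi5, chi5_zeta]
  ring

/-- **`μ` of a normal form** (`j = 0`): `μ = 2k + l` (`μ(ζ) = 0`, `μ(2) = 2`, `μ(5) = 1`).
[folklore] -/
theorem mu_normalForm : mu ((s : K3) * zeta ^ i * 2 ^ k * 5 ^ l * w ^ 3) = 2 * k + l := by
  have hs0 : (s : K3) ≠ 0 := by rcases hs with rfl | rfl <;> norm_num
  have hz : (zeta : K3) ≠ 0 := isPrimitiveRoot_zeta.ne_zero (by norm_num)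
  obtain ⟨h2, h5, -, -⟩ := mu_values
  rw [mu_mul (mul_ne_zero (mul_ne_zero (mul_ne_zero hs0 (pow_ne_zero _ hz))
      (pow_ne_zero _ two_ne_zero)) (pow_ne_zero _ (by norm_num))) (pow_ne_zero _ hw),
    mu_mul (mul_ne_zero (mul_ne_zero hs0 (pow_ne_zero _ hz)) (pow_ne_zero _ two_ne_zero))
      (pow_ne_zero _ (by norm_num)),
    mu_mul (mul_ne_zero hs0 (pow_ne_zero _ hz)) (pow_ne_zero _ two_ne_zero),
    mu_mul hs0 (pow_ne_zero _ hz), mu_sign hs, mu_pow hz, mu_zeta, mu_pow two_ne_zero, h2,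
    mu_pow (by norm_num), h5, mu_pow_three hw]
  ring

end Characters

/-! ### Classes modulo cubes -/

/-- **The class of a normal form**: `[s ζ^i λ^j 2^k 5^l w³] = [ζ^i λ^j 2^k 5^l]` (`s = ±1` and `w³`
are cubes). [folklore] -/
theorem cubeClass_normalForm {s : ℤ} (hs : s = 1 ∨ s = -1) (i j k l : ℕ) {w : K3} (hw : w ≠ 0) :
    cubeClass ((s : K3) * zeta ^ i * (zeta - 1) ^ j * 2 ^ k * 5 ^ l * w ^ 3) =
      cubeClass (zeta ^ i * (zeta - 1) ^ j * 2 ^ k * 5 ^ l : K3) := by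
  have hz : (zeta : K3) ≠ 0 := isPrimitiveRoot_zeta.ne_zero (by norm_num)
  have hm : (zeta ^ i * (zeta - 1) ^ j * 2 ^ k * 5 ^ l : K3) ≠ 0 :=
    mul_ne_zero (mul_ne_zero (mul_ne_zero (pow_ne_zero _ hz) (pow_ne_zero _ zeta_sub_one_ne_zero))
      (pow_ne_zero _ two_ne_zero)) (pow_ne_zero _ (by norm_num))
  rw [show (s : K3) * zeta ^ i * (zeta - 1) ^ j * 2 ^ k * 5 ^ l * w ^ 3 =
      (s * (zeta ^ i * (zeta - 1) ^ j * 2 ^ k * 5 ^ l)) * w ^ 3 by ring,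
    cubeClass_mul_pow_three (mul_ne_zero (by rcases hs with rfl | rfl <;> norm_num) hm) hw]
  rcases hs with rfl | rfl
  · rw [Int.cast_one, one_mul]
  · rw [Int.cast_neg, Int.cast_one, neg_one_mul, cubeClass_neg]

/-! ### Rationals that are not cubes in `K3` -/

/-- **A rational `q` with `3 ∤ ord_p(q)` is not a cube in `K3`**: `q = w³` gives `q² = N(w)³` on
taking norms `K3 → ℚ`. [folklore] -/
theorem ratCast_ne_cube {q : ℚ} (hq : q ≠ 0) {p : ℕ} [Fact p.Prime] (h : ¬ (3 : ℤ) ∣ padicValRat p q)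
    (w : K3) : (q : K3) ≠ w ^ 3 := by
  intro hw
  have hN := congrArg QuadraticAlgebra.norm hw
  have hnq : QuadraticAlgebra.norm (q : K3) = q ^ 2 := by
    rw [QuadraticAlgebra.norm_def, ratCast_re, ratCast_im]; ring
  rw [map_pow, hnq] at hN
  have hw0 : QuadraticAlgebra.norm w ≠ 0 := by
    intro h0; rw [h0, zero_pow three_ne_zero] at hN; exact pow_ne_zero 2 hq hN
  have hv := congrArg (padicValRat p) hN
  rw [padicValRat.pow, padicValRat.pow] at hv
  exact h ⟨2 * padicValRat p q - padicValRat p (QuadraticAlgebra.norm w), by push_cast at hv; omega⟩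

/-- **`[q] ≠ [q']` in `K3ˣ/K3ˣ³`** for non-zero rationals with `3 ∤ ord_p(q/q')`. [folklore] -/
theorem cubeClass_ratCast_ne {q q' : ℚ} (hq : q ≠ 0) (hq' : q' ≠ 0) {p : ℕ} [Fact p.Prime]
    (h : ¬ (3 : ℤ) ∣ padicValRat p (q / q')) : cubeClass (q : K3) ≠ cubeClass (q' : K3) := by
  intro he
  rw [cubeClass_eq_cubeClass_iff (by exact_mod_cast hq) (by exact_mod_cast hq')] at he
  obtain ⟨w, -, hw⟩ := he
  refine ratCast_ne_cube (div_ne_zero hq hq') h w ?_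
  push_cast
  rw [hw]; field_simp

/-- `[q] ≠ 1` for a non-zero rational with `3 ∤ ord_p(q)`. [folklore] -/
theorem cubeClass_ratCast_ne_one {q : ℚ} (hq : q ≠ 0) {p : ℕ} [Fact p.Prime]
    (h : ¬ (3 : ℤ) ∣ padicValRat p q) : cubeClass (q : K3) ≠ 1 := by
  have := cubeClass_ratCast_ne hq one_ne_zero (p := p) (by rwa [div_one])
  rwa [Rat.cast_one, Literature.NumberTheory.EllipticCurves.MordellDescent.cubeClass_one] at this

end K3

end Literature.NumberTheory.NumberFields

end
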